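import Summits.QuantumFields.YangMills.Theorems.ColdStartUniversalityLatticeLangevinDynkinSmooth
import Summits.QuantumFields.YangMills.Theorems.ColdStartUniversalityLatticeLangevinRegularFlowProgressive
import Summits.QuantumFields.YangMills.Theorems.ColdStartUniversalityLatticeLangevinCoeffBounds
import Literature.Analysis.FunctionSpaces.ItoProcessesProofs
import HarnessLib

/-!
# Crux K_A1 `UniformColdStartMixing` (stmt-QuantumFields-24809), rung `stub_fixedCutoffMixing`, (Inv) wall:
# step [2→SZZ] — the Dynkin formula in expectation FOR THE SZZ SYSTEM (plan-only skeleton, seat ym-line-csu-p1 g6)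

NOT a registered skeleton; a kernel-checked SIGNATURE for the next step.  Steps [1] (covariation theorem,
`Literature.Probability.Process.IsItoIntegral.integral_mul_sub_mul_sub`) and [2] (generic multidimensional Dynkin
formula in expectation, `dynkin_expectation_flat_of_contDiff`) are LANDED.  The stub below instantiates [2] for a
solution family of the SU(2) lattice Langevin system with the progressive-measurability clause of the regular flow
(`exists_regularFlow`): real coordinates `(e, i, j, c)` = Re/Im of the matrix entries `ρ(U_e)_{ij}`, drift/noise =
Re/Im of `latticeLangevinDynamics`'s coefficients, noise index = all flat coordinates `(e', n)` with zero coefficient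
for `e' ≠ e`.  Recipe: `Cruxes/UniformColdStartMixing/Lines/rung_fixedCutoffMixing.md` (g6 addendum).
RECORD-rung R3; YM mass gap NOT proved; K_A1 body untouched.
-/

set_option autoImplicit false

noncomputable section

namespace Summit.QuantumFields.YangMills.Cruxes.UniformColdStartMixing.RungFixedCutoffMixingDynkin

open MeasureTheory ProbabilityTheory Finset
open scoped NNReal
open Literature.Probability.Process Literature.MathematicalPhysics.QuantumFieldTheory
open Literature.MathematicalPhysics.QuantumLattice (fundamentalRep fundamentalLatticeRep continuous_fundamentalRep)
open Summit.QuantumFields.YangMills.Theorems.ColdStartUniversality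

/-- **Stub [2→SZZ] (OPEN): Dynkin's formula in expectation for the SU(2) lattice Langevin dynamics.**  For a
solution family `U` from every start with the regular-flow measurability clause, a start `x`, a `C³` compactly
supported test function `f` of the real coordinates of the link matrices, `s ≤ t` and a bounded `𝓕_s`-measurable
`Z`: `E[Z (f(X_t) - f(X_s))] = E[Z ∫_(s,t] (L f)(X_r) dr]` with the coordinate generator of the SZZ system. -/
theorem stub_szzDynkin (L : ℕ) [NeZero L] (β : ℝ) {Ω : Type} [MeasurableSpace Ω] {P : Measure Ω}
    [IsProbabilityMeasure P] {W : ℝ≥0 → Ω → (Edge 3 L × NoiseIdx 2 → ℝ)} (hW : IsFlatBrownian W P)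
    (U : GaugeConfig 3 L (Matrix.specialUnitaryGroup (Fin 2) ℂ) → ℝ≥0 → Ω →
      GaugeConfig 3 L (Matrix.specialUnitaryGroup (Fin 2) ℂ))
    (hU : ∀ x, (∀ ω, U x 0 ω = x) ∧
      (latticeLangevinDynamics (fundamentalLatticeRep 2) β).IsSolution (fundamentalRep (Fin 2))
        hW.natFiltration P W (U x))
    (hUm : ∀ i : ℝ≥0, Measurable[@Prod.instMeasurableSpace (Set.Iic i)
        (GaugeConfig 3 L (Matrix.specialUnitaryGroup (Fin 2) ℂ) × Ω) inferInstance
        (@Prod.instMeasurableSpace (GaugeConfig 3 L (Matrix.specialUnitaryGroup (Fin 2) ℂ)) Ω inferInstance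
          (hW.natFiltration i))]
      (fun q : Set.Iic i × (GaugeConfig 3 L (Matrix.specialUnitaryGroup (Fin 2) ℂ) × Ω) => U q.2.1 q.1 q.2.2))
    (x : GaugeConfig 3 L (Matrix.specialUnitaryGroup (Fin 2) ℂ))
    {f : (Edge 3 L × Fin 2 × Fin 2 × Bool → ℝ) → ℝ} (hf : ContDiff ℝ 3 f) (hfc : HasCompactSupport f)
    {s t : ℝ≥0} (hst : s ≤ t) {Z : Ω → ℝ} (hZ : StronglyMeasurable[hW.natFiltration s] Z) {C : ℝ}
    (hC : ∀ ω, |Z ω| ≤ C) :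
    let X : ℝ≥0 → Ω → (Edge 3 L × Fin 2 × Fin 2 × Bool → ℝ) := fun r ω q =>
      (fun z : ℂ => if q.2.2.2 then z.im else z.re)
        ((fundamentalRep (Fin 2) (U x r ω q.1) : Matrix (Fin 2) (Fin 2) ℂ) q.2.1 q.2.2.1)
    let b : (Edge 3 L × Fin 2 × Fin 2 × Bool) → ℝ≥0 → Ω → ℝ := fun q r ω =>
      (fun z : ℂ => if q.2.2.2 then z.im else z.re) ((latticeLangevinDynamics (fundamentalLatticeRep 2) β).drift
        (matrixConfig (fundamentalRep (Fin 2)) (U x r ω)) q.1 q.2.1 q.2.2.1)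
    let σ : (Edge 3 L × Fin 2 × Fin 2 × Bool) → (Edge 3 L × NoiseIdx 2) → ℝ≥0 → Ω → ℝ := fun q k r ω =>
      if k.1 = q.1 then (fun z : ℂ => if q.2.2.2 then z.im else z.re)
        ((latticeLangevinDynamics (fundamentalLatticeRep 2) β).noise
          (matrixConfig (fundamentalRep (Fin 2)) (U x r ω)) q.1 k.2 q.2.1 q.2.2.1) else 0
    ∫ ω, Z ω * (f (X t ω) - f (X s ω)) ∂P =
      ∫ ω, Z ω * (∫ r in Set.Ioc (s : ℝ) t,
        (∑ i, fderiv ℝ f (X r.toNNReal ω) (Pi.single i 1) * b i r.toNNReal ω +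
        (1 / 2) * ∑ i, ∑ j, fderiv ℝ (fun z ↦ fderiv ℝ f z (Pi.single i 1)) (X r.toNNReal ω) (Pi.single j 1) *
          ∑ n, σ i n r.toNNReal ω * σ j n r.toNNReal ω)) ∂P := by
  intro X b σ
  classical
  haveI := secondCountableTopology_su2
  haveI := borelSpace_config L
  obtain ⟨hU0, hUsol⟩ := hU x
  -- coefficient bounds
  obtain ⟨M, hM⟩ := exists_bound_coeff (L := L) β
  have hreIm : ∀ (c : Bool) (z : ℂ), |(fun z : ℂ => if c then z.im else z.re) z| ≤ ‖z‖ := by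
    intro c z; cases c
    · simpa using Complex.abs_re_le_norm z
    · simpa using Complex.abs_im_le_norm z
  -- measurability of the coordinate observables
  have hentry : ∀ (e : Edge 3 L) (i j : Fin 2) (c : Bool), Measurable fun V : GaugeConfig 3 L
      (Matrix.specialUnitaryGroup (Fin 2) ℂ) => (fun z : ℂ => if c then z.im else z.re) ((fundamentalRep (Fin 2) (V e) : Matrix (Fin 2) (Fin 2) ℂ) i j) := by
    intro e i j c
    have hc : Continuous fun V : GaugeConfig 3 L (Matrix.specialUnitaryGroup (Fin 2) ℂ) =>
        ((fundamentalRep (Fin 2) (V e) : Matrix (Fin 2) (Fin 2) ℂ) i j) :=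
      (continuous_apply j).comp ((continuous_apply i).comp
        ((continuous_fundamentalRep (n := Fin 2)).comp (continuous_apply e)))
    cases c
    · exact (Complex.continuous_re.comp hc).measurable
    · exact (Complex.continuous_im.comp hc).measurable
  have hdriftm : ∀ (e : Edge 3 L) (i j : Fin 2) (c : Bool), Measurable fun V : GaugeConfig 3 L
      (Matrix.specialUnitaryGroup (Fin 2) ℂ) =>
      (fun z : ℂ => if c then z.im else z.re) ((latticeLangevinDynamics (fundamentalLatticeRep 2) β).drift
        (matrixConfig (fundamentalRep (Fin 2)) V) e i j) := by
    intro e i j c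
    have hc : Continuous fun V : GaugeConfig 3 L (Matrix.specialUnitaryGroup (Fin 2) ℂ) =>
        (latticeLangevinDynamics (fundamentalLatticeRep 2) β).drift (matrixConfig (fundamentalRep (Fin 2)) V) e i j :=
      (continuous_apply j).comp ((continuous_apply i).comp (continuous_drift_matrixConfig β e))
    cases c
    · exact (Complex.continuous_re.comp hc).measurable
    · exact (Complex.continuous_im.comp hc).measurable
  have hnoisem : ∀ (e : Edge 3 L) (n : NoiseIdx 2) (i j : Fin 2) (c : Bool), Measurable fun V : GaugeConfig 3 L
      (Matrix.specialUnitaryGroup (Fin 2) ℂ) =>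
      (fun z : ℂ => if c then z.im else z.re) ((latticeLangevinDynamics (fundamentalLatticeRep 2) β).noise
        (matrixConfig (fundamentalRep (Fin 2)) V) e n i j) := by
    intro e n i j c
    have hc : Continuous fun V : GaugeConfig 3 L (Matrix.specialUnitaryGroup (Fin 2) ℂ) =>
        (latticeLangevinDynamics (fundamentalLatticeRep 2) β).noise (matrixConfig (fundamentalRep (Fin 2)) V) e n i j :=
      (continuous_apply j).comp ((continuous_apply i).comp (continuous_noise_matrixConfig β e n))
    cases c
    · exact (Complex.continuous_re.comp hc).measurable
    · exact (Complex.continuous_im.comp hc).measurable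
  -- the Itô integrals: the solution's complex ones, and zero integrals for the other links
  obtain ⟨Jc, hJc, hXeqC⟩ := hUsol.exists_ito
  have hzero : ∀ k : Edge 3 L × NoiseIdx 2, ∃ J0 : ℝ≥0 → Ω → ℝ,
      IsItoIntegral (fun _ _ => (0 : ℝ)) (fun r ω => W r ω k) J0 hW.natFiltration P ∧
        ∀ᵐ ω ∂P, ∀ t, J0 t ω = 0 := by
    intro k
    obtain ⟨J0, hJ0, -, -⟩ := exists_isItoIntegral_flatCoord hW k (H := fun _ _ => (0 : ℝ))
      (isStronglyProgressive_const _ _) (fun t => by simp [sqErr])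
    exact ⟨J0, hJ0, IsItoIntegral.ae_forall_eq_zero_of_integrand hJ0⟩
  choose J0 hJ0 hJ0z using hzero
  set J : (Edge 3 L × Fin 2 × Fin 2 × Bool) → (Edge 3 L × NoiseIdx 2) → ℝ≥0 → Ω → ℝ := fun q k =>
    if k.1 = q.1 then (fun t ω => (fun z : ℂ => if q.2.2.2 then z.im else z.re) (Jc q.1 k.2 q.2.1 q.2.2.1 t ω))
    else J0 k with hJdef
  refine dynkin_expectation_flat_of_contDiff (J := J) hW ?_ ?_ (M := M) ?_ ?_ ?_ ?_ ?_ ?_ hf hfc hst hZ hC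
  · -- `b` progressive
    intro q
    exact isStronglyProgressive_comp_flow hUm x (hdriftm q.1 q.2.1 q.2.2.1 q.2.2.2)
  · -- `σ` progressive
    intro q k
    by_cases hk : k.1 = q.1
    · have h := isStronglyProgressive_comp_flow hUm x (hnoisem q.1 k.2 q.2.1 q.2.2.1 q.2.2.2)
      have e1 : σ q k = fun r ω => (fun z : ℂ => if q.2.2.2 then z.im else z.re)
          ((latticeLangevinDynamics (fundamentalLatticeRep 2) β).noise
            (matrixConfig (fundamentalRep (Fin 2)) (U x r ω)) q.1 k.2 q.2.1 q.2.2.1) := by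
        funext r ω
        simp only [σ, hk, if_true]
      rw [e1]; exact h
    · have h := isStronglyProgressive_const hW.natFiltration (0 : ℝ)
      refine (show σ q k = fun _ _ => (0 : ℝ) from ?_) ▸ h
      funext r ω
      simp only [σ, hk, if_false]
  · -- `|b| ≤ M`
    intro q r ω
    exact (hreIm _ _).trans (hM (U x r ω) q.1 q.2.1 q.2.2.1).1
  · -- `|σ| ≤ M`
    intro q k r ω
    have hM0 : 0 ≤ M := (norm_nonneg _).trans (hM (U x r ω) q.1 q.2.1 q.2.2.1).1
    by_cases hk : k.1 = q.1
    · simp only [σ, hk, if_true]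
      exact (hreIm _ _).trans ((hM (U x r ω) q.1 q.2.1 q.2.2.1).2 k.2)
    · simp only [σ, hk, if_false, abs_zero]; exact hM0
  · -- the Itô integrals
    intro q k
    by_cases hk : k.1 = q.1
    · obtain ⟨e', n⟩ := k
      rcases q with ⟨e, i, j, c⟩
      simp only at hk
      obtain rfl : e' = e := hk
      have h := hJc e' n i j
      have e2 : J (e', i, j, c) (e', n) = fun t ω => (fun z : ℂ => if c then z.im else z.re) (Jc e' n i j t ω) := by
        simp only [hJdef, if_true]
      have e1 : σ (e', i, j, c) (e', n) = fun t ω => (fun z : ℂ => if c then z.im else z.re)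
          ((latticeLangevinDynamics (fundamentalLatticeRep 2) β).noise
            (matrixConfig (fundamentalRep (Fin 2)) (U x t ω)) e' n i j) := by
        funext t ω; simp only [σ, if_true]
      rw [e1, e2]
      cases c
      · simp only [Bool.false_eq_true, if_false]
        convert h.1 using 0
        exact Iff.rfl
      · simp only [if_true]
        convert h.2 using 0
        exact Iff.rfl
    · have h := hJ0 k
      have e1 : σ q k = fun _ _ => (0 : ℝ) := by funext r ω; simp only [σ, hk, if_false]
      have e2 : J q k = J0 k := by simp only [hJdef, hk, if_false]
      rw [e1, e2]; exact h
  · -- joint measurability of `X`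
    intro q
    exact measurable_comp_flow_toNNReal hUm x (hentry q.1 q.2.1 q.2.2.1 q.2.2.2)
  · -- adaptedness of `X`
    intro q t
    have h1 : Measurable[hW.natFiltration t] (U x t) := hUsol.adapted t
    exact ((hentry q.1 q.2.1 q.2.2.1 q.2.2.2).comp h1).stronglyMeasurable
  · -- the integral equations, coordinatewise (OPEN — the only remaining obligation; g6 ran out of time).
    -- Recipe (tried, ~50 lines, see g6 NOTES): for `q = (e, i, j, c)` filter on `hXeqC` (from `IsSolution.exists_ito`)
    -- and on `∀ k t, J0 k t ω = 0` (`hJ0z`, finite `k`: `Filter.eventually_all`); take Re/Im of the complex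
    -- identity (`Complex.add_re/add_im`, `Complex.re_sum/im_sum`); move Re/Im through the time integral with
    -- `intervalIntegral.integral_of_le` + `integral_re`/`integral_im` (integrand bounded by `M` (`hM`) and measurable in
    -- `s` via `measurable_comp_flow_toNNReal hUm x (hdriftm …)` ∘ `measurable_prodMk_left`, hence `IntervalIntegrable`);
    -- split `∑_{(e',n)} J = ∑_n Re/Im (Jc e n i j) + ∑_{e'≠e} ∑_n J0 = …` (`Fintype.sum_prod_type`, `Finset.sum_eq_single e`).
    -- Pitfall met: `hXeqC` is typed with `Fin (fundamentalLatticeRep 2).N` (defeq, not syntactically `Fin 2`) —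
    -- state the intermediate identities with `show`/`change` to the `Fin 2` form before rewriting.
    intro q
    sorry

end Summit.QuantumFields.YangMills.Cruxes.UniformColdStartMixing.RungFixedCutoffMixingDynkin

end
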